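import Summits.CriticalPhenomena.PercolationContinuityZ3.Theorems.PercNearOneGluingNoHeavyQuantGateStepNFree
import HarnessLib

/-!
# QUANT lane R8, T-DEC: THE THREE-ROOT GATE-COUPLING IDENTITY (common root gate) — the width-3 sibling of arm-1's two-root identity;
# an explicit re-gating mixture for three trees under one outer gate (census-2 g70/g71)

builds on p205010 (kernel theorem, internal audit signed; external expert review pending)

Support file (`--supports stmt-CriticalPhenomena-4575`), QUANT lane seat prim-quant-census-2 (gens 70–71); memo
`run/shared/lean/prim/quant/prim-quant-census-2-g70/RPM3-G70.md` §4 (the identity, read off exact LP certificates of tied sibling groups) and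
`run/shared/lean/prim/quant/prim-quant-census-2-g71/TIED3-G71.md`.  Theorems only (pure algebra of `gate`/`lconv`), standard axioms, no sorries.
Companion of arm-1 g45's `…QuantTwoRootGateCoupling` (`twoRoot_gateCoupling`); the DEC consequence inside `GateStepN` is the sequel file
`…QuantThreeRootGateStep`.

THE IDENTITY (`threeRoot_gateCoupling`).  Three trees `tᵢ = gate_p ρᵢ` with a COMMON root gate `p` (`ρᵢ` the opened trees: laws on `{0..Mᵢ}`
vanishing above their tops, otherwise arbitrary) under an outer gate `a` with `a·p ≠ 1`; write `s = a·p`.  Then, pointwise,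
  `gate_a(t₁ ∗ t₂ ∗ t₃) = α·A + β·gate_s(ρ₁ ∗ ρ₂ ∗ ρ₃) + γ′·(C₁ + C₂ + C₃)`,
  `α = 2(1−p)(2p−1)`,  `γ′ = (1−p)²/(1−s)`,  `β = p² − 3sγ′`  (so `α + β + 3γ′ = 1`),
  `Cᵢ = gate_s ρᵢ ∗ gate_s(ρ_j ∗ ρ_k)`,  and `A` ANY law with `A = (s/2)·(ρ₂∗ρ₃ + ρ₁∗ρ₃ + ρ₁∗ρ₂) + (1 − 3s/2)·δ₀`
  — e.g. `A = Σᵢ λᵢ·gate_{gᵢ}(ρ_j ∗ ρ_k)` for any `λᵢ gᵢ = s/2`, `Σ λᵢ = 1` (`threeRoot_A_of_weights`): "tree `i` ABSENT, the other two re-gated".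
On root patterns it reads `(1−a)δ₀₀₀ + a·Bern(p)^⊗3 = α·A + β·B₃ + γ·C` (check the three moments `ap`, `ap²`, `ap³`; both sides are
exchangeable); the count laws follow because the opened laws `ρᵢ` are untouched — `lconv3_gate_expand` writes any `gate ρ₁ q₁ ∗ gate ρ₂ q₂ ∗ gate ρ₃ q₃`
as the root-pattern mixture of the eight sub-forest convolutions.  The weights are nonnegative iff `p ≥ 1/2` and `3s(1−p)² ≤ p²(1−s)`.

WHY IT MATTERS (sequel file).  With `gᵢ = S/(R_j + R_k)`, `λᵢ = (R_j + R_k)/(2ΣR)` (`Rᵢ` the opened means, `S = s·ΣR`) every one of the seven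
components has mean exactly `S`, floor `≥ a·x` and at most `n₁+n₂+n₃+2` nontrivial gates — one fewer than `t₁ ⊔ t₂ ⊔ t₃` — so inside `LawDec.GateStepN`
(lead g42) each is an oracle instance: the first EXPLICIT width-3 certificate on the open core of the gate-elimination architecture (README V393/V400;
conjecture of record RCM: 0 / ≈ 11 500 numerically), valid for outer gates up to an explicit threshold `< 1`.

HONEST STATUS.  `GateStepN`, `GateStepNCore`, `FarTreeRow` remain OPEN; RATE class (log\*) and the honest sentence of
`run/shared/lean/prim/quant/README.md` unchanged.  [this work]; two-root identity: prim-quant-arm-1 g45; `lconv_assoc`: lead g42 (this lane).  Nothing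
here is a published result.  The gluing rows served [cite: KozmaNitzan2024, Conjecture 3 (p. 15)]; product measure [cite: Grimmett1999, §1.3 p. 10].
-/

noncomputable section

namespace Summit.CriticalPhenomena.PercolationContinuityZ3.Theorems

namespace Quant

open Finset

namespace LawDec

/-! ### Algebra: tops, a permutation, the three-gate expansion -/

/-- a gated law vanishes where the law does, above a top `M`. [this work] -/
theorem gate_eq_zero_of_top (M : ℕ) (ν : ℕ → ℝ) (q : ℝ) (hνM : ∀ h, M < h → ν h = 0) (h : ℕ) (hh : M < h) :
    gate ν q h = 0 := by
  rw [gate_apply, hνM h hh, if_neg (by omega)]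
  ring

/-- **the declared top of the left factor does not matter** once it covers the law: `lconv M₁' M₂ μ ν = lconv M₁ M₂ μ ν` for
`M₁ ≤ M₁'` and `μ` vanishing above `M₁`. [this work] -/
theorem lconv_top_left_of_le (M₁ M₁' M₂ : ℕ) (μ ν : ℕ → ℝ) (hM : M₁ ≤ M₁') (hμM : ∀ h, M₁ < h → μ h = 0) (h : ℕ) :
    lconv M₁' M₂ μ ν h = lconv M₁ M₂ μ ν h := by
  unfold lconv
  symm
  refine Finset.sum_subset (fun i hi => ?_) (fun i hi hi' => ?_)
  · rw [Finset.mem_range] at hi ⊢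
    omega
  · rw [Finset.mem_range] at hi hi'
    refine Finset.sum_eq_zero fun k _ => ?_
    rw [hμM i (by omega)]
    split_ifs <;> simp

/-- permuting the first two factors of a triple convolution (with its tops): `ρ₂ ∗ (ρ₁ ∗ ρ₃) = (ρ₁ ∗ ρ₂) ∗ ρ₃`. [this work] -/
theorem lconv_lconv_swap (M₁ M₂ M₃ : ℕ) (ρ₁ ρ₂ ρ₃ : ℕ → ℝ) (h : ℕ) :
    lconv M₂ (M₁ + M₃) ρ₂ (lconv M₁ M₃ ρ₁ ρ₃) h = lconv (M₁ + M₂) M₃ (lconv M₁ M₂ ρ₁ ρ₂) ρ₃ h := by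
  rw [lconv_lconv_right_apply, lconv_lconv_left_apply, Finset.sum_comm]
  refine Finset.sum_congr rfl fun i _ => Finset.sum_congr rfl fun k _ => Finset.sum_congr rfl fun b _ => ?_
  by_cases e : i + k + b = h
  · rw [if_pos e, if_pos (by omega)]
    ring
  · rw [if_neg e, if_neg (by omega)]

/-- **the three-gate expansion**: for laws `ρᵢ` on `{0..Mᵢ}` and gates `qᵢ`,
`gate_{q₁}ρ₁ ∗ gate_{q₂}ρ₂ ∗ gate_{q₃}ρ₃ = Σ_{G ⊆ {1,2,3}} Π_{i∈G} qᵢ Π_{i∉G} (1−qᵢ) · (∗_{i∈G} ρᵢ)` — the count law is the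
root-pattern mixture of the sub-forest convolutions. [this work] -/
theorem lconv3_gate_expand (M₁ M₂ M₃ : ℕ) (ρ₁ ρ₂ ρ₃ : ℕ → ℝ) (q₁ q₂ q₃ : ℝ)
    (h₁M : ∀ h, M₁ < h → ρ₁ h = 0) (h₂M : ∀ h, M₂ < h → ρ₂ h = 0) (h₃M : ∀ h, M₃ < h → ρ₃ h = 0) (h : ℕ) :
    lconv (M₁ + M₂) M₃ (lconv M₁ M₂ (gate ρ₁ q₁) (gate ρ₂ q₂)) (gate ρ₃ q₃) h
      = q₁ * q₂ * q₃ * lconv (M₁ + M₂) M₃ (lconv M₁ M₂ ρ₁ ρ₂) ρ₃ h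
        + q₁ * q₂ * (1 - q₃) * lconv M₁ M₂ ρ₁ ρ₂ h + q₁ * (1 - q₂) * q₃ * lconv M₁ M₃ ρ₁ ρ₃ h
        + (1 - q₁) * q₂ * q₃ * lconv M₂ M₃ ρ₂ ρ₃ h
        + q₁ * (1 - q₂) * (1 - q₃) * ρ₁ h + (1 - q₁) * q₂ * (1 - q₃) * ρ₂ h + (1 - q₁) * (1 - q₂) * q₃ * ρ₃ h
        + (1 - q₁) * (1 - q₂) * (1 - q₃) * (if h = 0 then (1 : ℝ) else 0) := by
  have eF : lconv M₁ M₂ (gate ρ₁ q₁) (gate ρ₂ q₂)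
      = fun k => (q₁ * q₂) * lconv M₁ M₂ ρ₁ ρ₂ k
          + 1 * ((q₁ * (1 - q₂)) * ρ₁ k
            + 1 * (((1 - q₁) * q₂) * ρ₂ k + ((1 - q₁) * (1 - q₂)) * (if k = 0 then (1 : ℝ) else 0))) := by
    funext k
    rw [lconv_gate_left M₁ M₂ ρ₁ _ q₁ (gate_eq_zero_of_top M₂ ρ₂ q₂ h₂M) k, lconv_gate_right M₁ M₂ ρ₁ ρ₂ q₂ h₁M k,
      gate_apply ρ₂ q₂ k]
    ring
  have hFM : ∀ k, M₁ + M₂ < k → lconv M₁ M₂ (gate ρ₁ q₁) (gate ρ₂ q₂) k = 0 :=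
    fun k hk => lconv_eq_zero _ _ _ _ k hk
  rw [lconv_gate_right (M₁ + M₂) M₃ _ ρ₃ q₃ hFM h, eF, lconv_lin_left, lconv_lin_left, lconv_lin_left]
  beta_reduce
  rw [lconv_top_left_of_le M₁ (M₁ + M₂) M₃ ρ₁ ρ₃ (by omega) h₁M h,
    lconv_top_left_of_le M₂ (M₁ + M₂) M₃ ρ₂ ρ₃ (by omega) h₂M h, lconv_delta_left (M₁ + M₂) M₃ ρ₃ h₃M h]
  ring

/-! ### The identity -/

/-- **THE THREE-ROOT GATE-COUPLING IDENTITY (common root gate).**  Laws `ρᵢ` on `{0..Mᵢ}` (vanishing above the tops), a root gate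
`p`, an outer gate `a` with `1 − a·p ≠ 0`, and ANY `A` with `A = (ap/2)·(ρ₂∗ρ₃ + ρ₁∗ρ₃ + ρ₁∗ρ₂) + (1 − 3ap/2)·δ₀`.  Then pointwise
`gate_a(gate_p ρ₁ ∗ gate_p ρ₂ ∗ gate_p ρ₃) = α·A + β·gate_{ap}(ρ₁∗ρ₂∗ρ₃) + γ′·(C₁ + C₂ + C₃)` with `α = 2(1−p)(2p−1)`,
`γ′ = (1−p)²/(1−ap)`, `β = p² − 3apγ′`, `Cᵢ = gate_{ap}ρᵢ ∗ gate_{ap}(ρ_j∗ρ_k)`. [this work] -/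
theorem threeRoot_gateCoupling (M₁ M₂ M₃ : ℕ) (ρ₁ ρ₂ ρ₃ A : ℕ → ℝ) (p a : ℝ)
    (h₁M : ∀ h, M₁ < h → ρ₁ h = 0) (h₂M : ∀ h, M₂ < h → ρ₂ h = 0) (h₃M : ∀ h, M₃ < h → ρ₃ h = 0) (hap : 1 - a * p ≠ 0)
    (hA : ∀ h, A h = (a * p / 2) * (lconv M₂ M₃ ρ₂ ρ₃ h + lconv M₁ M₃ ρ₁ ρ₃ h + lconv M₁ M₂ ρ₁ ρ₂ h)
      + (1 - 3 * (a * p) / 2) * (if h = 0 then (1 : ℝ) else 0)) (h : ℕ) :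
    gate (lconv (M₁ + M₂) M₃ (lconv M₁ M₂ (gate ρ₁ p) (gate ρ₂ p)) (gate ρ₃ p)) a h
      = (2 * (1 - p) * (2 * p - 1)) * A h
        + (p ^ 2 - 3 * (a * p) * ((1 - p) ^ 2 / (1 - a * p)))
            * gate (lconv (M₁ + M₂) M₃ (lconv M₁ M₂ ρ₁ ρ₂) ρ₃) (a * p) h
        + ((1 - p) ^ 2 / (1 - a * p))
            * (lconv M₁ (M₂ + M₃) (gate ρ₁ (a * p)) (gate (lconv M₂ M₃ ρ₂ ρ₃) (a * p)) h
              + lconv M₂ (M₁ + M₃) (gate ρ₂ (a * p)) (gate (lconv M₁ M₃ ρ₁ ρ₃) (a * p)) h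
              + lconv (M₁ + M₂) M₃ (gate (lconv M₁ M₂ ρ₁ ρ₂) (a * p)) (gate ρ₃ (a * p)) h) := by
  have h₁₂M : ∀ k, M₁ + M₂ < k → lconv M₁ M₂ ρ₁ ρ₂ k = 0 := fun k hk => lconv_eq_zero _ _ _ _ k hk
  have h₁₃M : ∀ k, M₁ + M₃ < k → lconv M₁ M₃ ρ₁ ρ₃ k = 0 := fun k hk => lconv_eq_zero _ _ _ _ k hk
  have h₂₃M : ∀ k, M₂ + M₃ < k → lconv M₂ M₃ ρ₂ ρ₃ k = 0 := fun k hk => lconv_eq_zero _ _ _ _ k hk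
  rw [gate_apply _ a h, lconv3_gate_expand M₁ M₂ M₃ ρ₁ ρ₂ ρ₃ p p p h₁M h₂M h₃M h, hA h,
    gate_apply (lconv (M₁ + M₂) M₃ (lconv M₁ M₂ ρ₁ ρ₂) ρ₃) (a * p) h,
    -- C₁
    lconv_gate_left M₁ (M₂ + M₃) ρ₁ _ (a * p) (gate_eq_zero_of_top (M₂ + M₃) _ (a * p) h₂₃M) h,
    lconv_gate_right M₁ (M₂ + M₃) ρ₁ (lconv M₂ M₃ ρ₂ ρ₃) (a * p) h₁M h,
    gate_apply (lconv M₂ M₃ ρ₂ ρ₃) (a * p) h, lconv_assoc M₁ M₂ M₃ ρ₁ ρ₂ ρ₃,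
    -- C₂
    lconv_gate_left M₂ (M₁ + M₃) ρ₂ _ (a * p) (gate_eq_zero_of_top (M₁ + M₃) _ (a * p) h₁₃M) h,
    lconv_gate_right M₂ (M₁ + M₃) ρ₂ (lconv M₁ M₃ ρ₁ ρ₃) (a * p) h₂M h,
    gate_apply (lconv M₁ M₃ ρ₁ ρ₃) (a * p) h, lconv_lconv_swap M₁ M₂ M₃ ρ₁ ρ₂ ρ₃ h,
    -- C₃
    lconv_gate_left (M₁ + M₂) M₃ (lconv M₁ M₂ ρ₁ ρ₂) _ (a * p) (gate_eq_zero_of_top M₃ ρ₃ (a * p) h₃M) h,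
    lconv_gate_right (M₁ + M₂) M₃ (lconv M₁ M₂ ρ₁ ρ₂) ρ₃ (a * p) h₁₂M h, gate_apply ρ₃ (a * p) h]
  field_simp
  ring

/-- the natural `A`-part: `A = Σᵢ λᵢ·gate_{gᵢ}(ρ_j ∗ ρ_k)` with `λᵢ gᵢ = ap/2` and `Σ λᵢ = 1` has the required form. [this work] -/
theorem threeRoot_A_of_weights (M₁ M₂ M₃ : ℕ) (ρ₁ ρ₂ ρ₃ : ℕ → ℝ) (s l₁ l₂ l₃ g₁ g₂ g₃ : ℝ)
    (hl₁ : l₁ * g₁ = s / 2) (hl₂ : l₂ * g₂ = s / 2) (hl₃ : l₃ * g₃ = s / 2) (hl : l₁ + l₂ + l₃ = 1) (h : ℕ) :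
    l₁ * gate (lconv M₂ M₃ ρ₂ ρ₃) g₁ h + l₂ * gate (lconv M₁ M₃ ρ₁ ρ₃) g₂ h + l₃ * gate (lconv M₁ M₂ ρ₁ ρ₂) g₃ h
      = (s / 2) * (lconv M₂ M₃ ρ₂ ρ₃ h + lconv M₁ M₃ ρ₁ ρ₃ h + lconv M₁ M₂ ρ₁ ρ₂ h)
        + (1 - 3 * s / 2) * (if h = 0 then (1 : ℝ) else 0) := by
  rw [gate_apply (lconv M₂ M₃ ρ₂ ρ₃) g₁ h, gate_apply (lconv M₁ M₃ ρ₁ ρ₃) g₂ h, gate_apply (lconv M₁ M₂ ρ₁ ρ₂) g₃ h]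
  have e₁ : l₁ * (1 - g₁) = l₁ - s / 2 := by rw [mul_sub, mul_one, hl₁]
  have e₂ : l₂ * (1 - g₂) = l₂ - s / 2 := by rw [mul_sub, mul_one, hl₂]
  have e₃ : l₃ * (1 - g₃) = l₃ - s / 2 := by rw [mul_sub, mul_one, hl₃]
  calc l₁ * (g₁ * lconv M₂ M₃ ρ₂ ρ₃ h + (1 - g₁) * (if h = 0 then (1 : ℝ) else 0))
        + l₂ * (g₂ * lconv M₁ M₃ ρ₁ ρ₃ h + (1 - g₂) * (if h = 0 then (1 : ℝ) else 0))
        + l₃ * (g₃ * lconv M₁ M₂ ρ₁ ρ₂ h + (1 - g₃) * (if h = 0 then (1 : ℝ) else 0))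
      = (l₁ * g₁) * lconv M₂ M₃ ρ₂ ρ₃ h + (l₂ * g₂) * lconv M₁ M₃ ρ₁ ρ₃ h + (l₃ * g₃) * lconv M₁ M₂ ρ₁ ρ₂ h
        + (l₁ * (1 - g₁) + l₂ * (1 - g₂) + l₃ * (1 - g₃)) * (if h = 0 then (1 : ℝ) else 0) := by ring
    _ = _ := by rw [hl₁, hl₂, hl₃, e₁, e₂, e₃]; linear_combination (if h = 0 then (1 : ℝ) else 0) * hl

end LawDec

end Quant

end Summit.CriticalPhenomena.PercolationContinuityZ3.Theorems
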